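import Mathlib.Algebra.Module.Torsion.Basic
import Mathlib.GroupTheory.Index
import Mathlib.GroupTheory.QuotientGroup.Basic
import HarnessLib

/-!
# Route `ByReductionTypeAtTwo`, item `OrdKatoHalfAtTwo` (stmt-BirchSwinnertonDyer-19271), TOWER road, the
# GOOD-ORDINARY local constant at `v ∣ 2`: KERNEL BRICK G1 — dévissage of the `p`-torsion of coinvariants
# along an invariant map with invariant lifts

HONEST FRAMING (cell `bsd-2adic`, run/shared/lean/pub/bsd-2adic/, seat `bsd-2adic-tower-1` GEN 11, HUMAN RULINGS
D-0036 / D-0054 / D-0074): TOOL theorem only (pure algebra; no definition, no named fact, no `sorry`); closes nothing by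
itself; nothing booked; BSD is not proved by any of this. First brick of the KERNELISATION of the consumed projection
`#𝒦_{v,n}[2^∞][2] ≤ 4` (`pTorsion_localTowerKer_at_two_le_four`, `Theorems/ByReductionTypeAtTwoTowerLayerNumeric.lean`) of the
PRINT binder `hS34 = Greenberg1999.lemma34_localTowerKerPrimary_cyclicExtension_rat` (Greenberg, LNM 1716, §3 Lemma 3.4 with
Prop. 2.5: at a good ORDINARY `v ∣ p` the local tower kernel is cyclic-by-cyclic), scope memo
HOME/tower/SCOPE-hS34-layer-kernel-at-2-GEN7.md §1 step 1 («dévissage»). By the tree's BRICK 11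
(`MultTowerNS2.finite_torsionBy_localTowerKerPrimary_and_card_le`) `𝒦_{v,n}[p^∞][p]` embeds into the `p`-torsion of the
coinvariants `M_∞/(g − 1)M_∞`, `M_∞ = E(K̄_v)^{H_{v,∞}}`; this file splits that `p`-torsion along the reduction map:

* `natCard_torsionBy_quotient_le_of_invariant` — for an additive group `M` with an endomorphism `D` («`g − 1`») and an
  additive map `r : M → T` («reduction») with `r ∘ D = 0` («`g` acts trivially on the reductions») such that every value
  `r x` is attained on an element killed by `D` («every reduction lifts to a `g`-FIXED point», Hensel), and an injective
  `j : M₁ ↪ M` whose image contains `ker r`, intertwining an endomorphism `D₁` of `M₁` with `D`: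
  `#(M/D M)[p] ≤ #(M₁/D₁ M₁)[p] · #T[p]`, with finiteness (any `p : ℕ`).
  Proof: `r` descends to `r̄ : M/DM → T`; on the `p`-torsion subgroup `P` of `M/DM`, `#P = #r̄(P) · #(P ∩ ker r̄)`,
  `r̄(P) ⊆ T[p]`, and a class `[x] ∈ P ∩ ker r̄` has `x = j x₁`, `p x = D y`, `y = y₁ + y₀` with `D y₀ = 0`, `r y₀ = r y`,
  `y₁ = j y₁'`, so `p x₁ = D₁ y₁'`: `[x]` is the image of a `p`-torsion class of `M₁/D₁ M₁`.

References: R. Greenberg, LNM 1716 (1999), §3 Lemma 3.4 (p. 89) with Prop. 2.5 (p. 80) (the extension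
`0 → ker a_{v_n} → ker r_{v_n} → ker b_{v_n} → 0`); J.-P. Serre, *Local Fields*, XIII §1; scope memo §1.
-/

set_option autoImplicit false
-- the Theorems namespace of this sub repeats the summit name by design (D-0017 nested layout: Summit.<S>.<Sub>)
set_option linter.dupNamespace false

noncomputable section

open scoped Classical

universe u v

namespace Summit.BirchSwinnertonDyer.BirchSwinnertonDyer.Theorems.GoodOrdTower

variable {M : Type u} {M₁ : Type u} {T : Type v} [AddCommGroup M] [AddCommGroup M₁] [AddCommGroup T]

/-- **Dévissage of the `p`-torsion of coinvariants along an invariant map with invariant lifts.** Let `M` be an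
additive group with an endomorphism `D` («`g − 1`»), `r : M → T` additive with `r ∘ D = 0` and such that every `x` has an
`x₀` with `D x₀ = 0` and `r x₀ = r x` («invariant lifts»); let `j : M₁ ↪ M` be an injective additive map whose image
contains `ker r` and `D₁` an endomorphism of `M₁` with `j ∘ D₁ = D ∘ j` (the restriction of `D` to `ker r`). If the `p`-torsion of
`M₁/D₁ M₁` and of `T` are finite, then the `p`-torsion of `M/D M` is finite and
`#(M/D M)[p] ≤ #(M₁/D₁ M₁)[p] · #T[p]` (any `p : ℕ`). This is Greenberg's extension
`0 → ker a_{v_n} → ker r_{v_n} → ker b_{v_n} → 0` (LNM 1716 p. 89) in coinvariant form: `r` descends to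
`r̄ : M/DM → T`; on the `p`-torsion subgroup `P` of `M/DM`, `#P = #r̄(P) · #(P ∩ ker r̄)`, `r̄(P) ⊆ T[p]`, and a class
`[x] ∈ P ∩ ker r̄` has `x = j x₁`, `p x = D y`, `y = y₁ + y₀` with `D y₀ = 0`, `r y₀ = r y`, so `p x = D y₁` with
`y₁ ∈ j(M₁)`: `[x]` is the image of the `p`-torsion class `[x₁]` of `M₁/D₁ M₁`.
[cite: GreenbergLNM1716, §3 Lemma 3.4 (proof, p. 89)] -/
theorem natCard_torsionBy_quotient_le_of_invariant (D : M →+ M) (r : M →+ T) (hrD : ∀ x, r (D x) = 0)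
    (hlift : ∀ x : M, ∃ x₀ : M, D x₀ = 0 ∧ r x₀ = r x)
    (j : M₁ →+ M) (hj : Function.Injective j) (hrj : ∀ y, r y = 0 → ∃ x, j x = y)
    (D₁ : M₁ →+ M₁) (hD₁ : ∀ x, j (D₁ x) = D (j x)) (p : ℕ)
    [Finite {c : M₁ ⧸ D₁.range // p • c = 0}] [Finite {t : T // p • t = 0}] :
    Finite {c : M ⧸ D.range // p • c = 0} ∧
      Nat.card {c : M ⧸ D.range // p • c = 0} ≤
        Nat.card {c : M₁ ⧸ D₁.range // p • c = 0} * Nat.card {t : T // p • t = 0} := by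
  -- notation
  let Q := M ⧸ D.range
  let Q₁ := M₁ ⧸ D₁.range
  -- `r` descends to `r̄ : M/DM → T`
  have hle : D.range ≤ r.ker := by
    rintro _ ⟨x, rfl⟩
    exact (AddMonoidHom.mem_ker).mpr (hrD x)
  let rbar : Q →+ T := QuotientAddGroup.lift D.range r hle
  have hrbar : ∀ x : M, rbar (QuotientAddGroup.mk x) = r x := fun x ↦ QuotientAddGroup.lift_mk' _ _ x
  -- the map `M₁/D₁M₁ → M/DM` induced by `j`
  have hle₁ : D₁.range ≤ D.range.comap j := by
    rintro _ ⟨x, rfl⟩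
    exact ⟨j x, (hD₁ x).symm⟩
  let ι : Q₁ →+ Q := QuotientAddGroup.map D₁.range D.range j hle₁
  have hι : ∀ x : M₁, ι (QuotientAddGroup.mk x) = QuotientAddGroup.mk (j x) := fun x ↦
    QuotientAddGroup.map_mk' _ _ _ _ x
  -- the `p`-torsion subgroups
  let P : AddSubgroup Q := AddSubgroup.torsionBy Q (p : ℤ)
  have hP : ∀ c : Q, c ∈ P ↔ p • c = 0 := fun c ↦ AddSubgroup.torsionBy.nsmul_iff
  let PT : AddSubgroup T := AddSubgroup.torsionBy T (p : ℤ)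
  have hPT : ∀ t : T, t ∈ PT ↔ p • t = 0 := fun t ↦ AddSubgroup.torsionBy.nsmul_iff
  let P₁ : AddSubgroup Q₁ := AddSubgroup.torsionBy Q₁ (p : ℤ)
  have hP₁ : ∀ c : Q₁, c ∈ P₁ ↔ p • c = 0 := fun c ↦ AddSubgroup.torsionBy.nsmul_iff
  haveI hPTfin : Finite PT :=
    Finite.of_equiv _ (Equiv.subtypeEquivRight fun t ↦ (hPT t).symm)
  haveI hP₁fin : Finite P₁ :=
    Finite.of_equiv _ (Equiv.subtypeEquivRight fun c ↦ (hP₁ c).symm)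
  -- `φ = r̄|_P : P → T`; `#P = #range φ · #ker φ`
  let φ : P →+ T := rbar.comp P.subtype
  have hdec : Nat.card P = Nat.card (P ⧸ φ.ker) * Nat.card φ.ker :=
    AddSubgroup.card_eq_card_quotient_mul_card_addSubgroup _
  have hq : Nat.card (P ⧸ φ.ker) = Nat.card φ.range :=
    Nat.card_congr (QuotientAddGroup.quotientKerEquivRange φ).toEquiv
  -- `range φ ⊆ T[p]`
  have hrange_le : φ.range ≤ PT := by
    rintro _ ⟨c, rfl⟩
    rw [hPT]
    change p • rbar (c : Q) = 0
    rw [← map_nsmul, (hP c.1).mp c.2, map_zero]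
  haveI hrange_fin : Finite φ.range := Finite.of_injective _ (AddSubgroup.inclusion_injective hrange_le)
  have hrange : Nat.card φ.range ≤ Nat.card PT := AddSubgroup.card_le_of_le hrange_le
  -- `ker φ ↪ (M₁/D₁M₁)[p]`: a class `[x]` with `p[x] = 0`, `r x = 0` is the image of a `p`-torsion class of `M₁/D₁M₁`
  have hker_mem : ∀ k : φ.ker, ∃ x : M₁, ι (QuotientAddGroup.mk x) = ((k : P) : Q) ∧
      (QuotientAddGroup.mk x : Q₁) ∈ P₁ := by
    intro k
    obtain ⟨x, hx⟩ := QuotientAddGroup.mk_surjective ((k : P) : Q)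
    have hk0 : φ k = 0 := k.2
    have hrx : r x = 0 := by
      change rbar ((k : P) : Q) = 0 at hk0
      rw [← hx, hrbar] at hk0
      exact hk0
    obtain ⟨x₁, rfl⟩ := hrj x hrx
    have hpx : (p • QuotientAddGroup.mk (j x₁) : Q) = 0 := by rw [hx]; exact (hP _).mp (k : P).2
    rw [← QuotientAddGroup.mk_nsmul, QuotientAddGroup.eq_zero_iff] at hpx
    obtain ⟨y, hy⟩ := hpx
    obtain ⟨y₀, hDy₀, hry₀⟩ := hlift y
    obtain ⟨y₁, hy₁⟩ := hrj (y - y₀) (by rw [map_sub, hry₀, sub_self])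
    refine ⟨x₁, by rw [hι, hx], ?_⟩
    rw [hP₁, ← QuotientAddGroup.mk_nsmul, QuotientAddGroup.eq_zero_iff]
    refine ⟨y₁, hj ?_⟩
    rw [hD₁, hy₁, map_sub, hDy₀, sub_zero, hy, map_nsmul]
  let ψ : φ.ker → P₁ := fun k ↦ ⟨QuotientAddGroup.mk (hker_mem k).choose, (hker_mem k).choose_spec.2⟩
  have hψ : Function.Injective ψ := by
    intro k k' h
    have h1 : (QuotientAddGroup.mk (hker_mem k).choose : Q₁) = QuotientAddGroup.mk (hker_mem k').choose :=
      congrArg Subtype.val h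
    have h2 : ((k : P) : Q) = ((k' : P) : Q) := by
      rw [← (hker_mem k).choose_spec.1, ← (hker_mem k').choose_spec.1, h1]
    exact Subtype.ext (Subtype.ext h2)
  haveI hker_fin : Finite φ.ker := Finite.of_injective ψ hψ
  have hker : Nat.card φ.ker ≤ Nat.card P₁ := Nat.card_le_card_of_injective ψ hψ
  -- finiteness of `P` and the count
  have hPcard : Nat.card P = Nat.card φ.range * Nat.card φ.ker := by rw [hdec, hq]
  haveI hPfin : Finite P := by
    apply Nat.finite_of_card_ne_zero
    rw [hPcard]
    exact mul_ne_zero (Nat.card_pos (α := φ.range)).ne' (Nat.card_pos (α := φ.ker)).ne'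
  have e : Nat.card {c : Q // p • c = 0} = Nat.card P :=
    Nat.card_congr (Equiv.subtypeEquivRight fun c ↦ (hP c).symm)
  have e₁ : Nat.card {c : Q₁ // p • c = 0} = Nat.card P₁ :=
    Nat.card_congr (Equiv.subtypeEquivRight fun c ↦ (hP₁ c).symm)
  have eT : Nat.card {t : T // p • t = 0} = Nat.card PT :=
    Nat.card_congr (Equiv.subtypeEquivRight fun t ↦ (hPT t).symm)
  refine ⟨Finite.of_equiv _ (Equiv.subtypeEquivRight fun c ↦ hP c), ?_⟩
  rw [e, e₁, eT, hPcard, mul_comm]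
  exact Nat.mul_le_mul hker hrange

end Summit.BirchSwinnertonDyer.BirchSwinnertonDyer.Theorems.GoodOrdTower

end
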